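import Summits.QuantumFields.YangMills.Theorems.PoincareLipschitzMinimiserBallBridge
import Mathlib.Analysis.InnerProductSpace.PiL2
import Mathlib.MeasureTheory.Integral.Bochner.Set
import Mathlib.Analysis.Calculus.ContDiff.Defs
import HarnessLib

/-!
# Crux `BlockLipschitzL` (stmt-QuantumFields-23533) ∕ `HistoryTailL` (stmt-QuantumFields-19936), LINE 25 «CompactnessTransfer»,
# stub S1″ `stub_uniformSmallScaleEnergy` — FILE 2 «S1″ FROM THREE PRINTED ROWS»

Cell `ym3-torus` (YM ladder rung R3 = continuum SU(2) Yang–Mills on T³ — a RUNG, NOT the Clay problem: not d = 4, not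
infinite volume, not a mass gap); WIDTH helper seat `ym-ust-19936-w3` g15.  Helper `--supports stmt-QuantumFields-19936`;
THEOREMS ONLY (0 `def`, 0 `sorry`, default heartbeats); imports: FILE 1 ✓`PoincareLipschitzMinimiserBallBridge` (the ball
bridge `energy_ball_le_of_cubeMin` + cube ∕ ball letters; through it lit ✓`SobolevDomainProofs` and ✓`PoincareLipschitzSamplingCells`),
Mathlib.

WHAT THIS FILE DOES.  The continuum stub S1″ of LINE 25 (ideator ym-r3-idea-2 g14∕g15, v1.4 text `S1pp`, Sobolev vocabulary):
«for every `Λ, ε > 0` there is `r₁ ∈ (0, 1∕8]` such that every finite-energy unit `W^{1,2}` map `U : Q → S³ ⊂ ℝ⁴` on the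
open unit cube `Q ⊂ ℝ³` which minimises the Dirichlet energy among finite-energy unit `W^{1,2}` competitors agreeing with
it off a compact sub-cube, with `E(U; Q) ≤ Λ`, has `E(U; Q_r) ≤ ε·r` for all `r ≤ r₁`» is «not verbatim in print as ONE
theorem» (LEAD ★w1-19936 g10, 12:24:26Z (A6)).  Here it is DERIVED BY KERNEL from three rows each of which IS a printed
theorem with a single locator, all stated in the same `HasWeakFDerivOn ⟨Q, hQ⟩ volume` vocabulary for maps that are
energy minimising on the balls `B̄_ρ(y) ⊂ Q` in the sense of [Simon1996, §2.1] (competitors = finite-energy unit `W^{1,2}(Q)`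
maps agreeing with the minimiser off a smaller concentric ball):
* (M) MONOTONICITY — `σ⁻¹·E(U; B_σ(y)) ≤ ρ⁻¹·E(U; B_ρ(y))` for `0 < σ ≤ ρ`, `B̄_ρ(y) ⊂ Q` [Simon1996, §2.4 (ii)]
  [SchoenUhlenbeck1982, §2 (monotonicity)] (minimisers are stationary, §2.2 (v));
* (C) COMPACTNESS — a sequence of such minimisers with `E(·; Q) ≤ Λ` has a subsequence converging in `L²` on balls to a
  minimiser of the same class, WITH convergence of the energies on every ball `B̄_ρ(y) ⊂ Q` [Luckhaus1988, compactness theorem]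
  [Simon1996, §2.9 Lemma 1 + Remark (1)] (finite total energy and a pointwise-unit representative of the limit: Remark (2)
  + weak lower semicontinuity);
* (R) REGULARITY — such a minimiser from the 3-dimensional domain `Q` into `S³` has a `C¹` (indeed real-analytic)
  representative on `Q` whose classical gradient is the weak gradient a.e. [SchoenUhlenbeck1984, Theorem: interior
  regularity for `n ≤ d(k)`, here `n = 3 = d(3)`] [Simon1996, §2.10 Cor. 1–2, §3.4 Cor. 1 Remark] (no non-constant
  minimising tangent map `ℝ³ → S³`: the stability inequality `(k−2)∫|∇φ|²η² ≤ k∫|∇η|²` at `k = 3` with Hardy's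
  constant `¼` caps `E_{S²}(φ) ≤ 3π`, while a non-constant harmonic 2-sphere in `S³` has energy `≥ 8π`).

WHAT IS PROVED (ns `…Theorems.PoincareLipschitzUniformSmallScaleEnergyOfRows`).
* ★★★ `uniformSmallScaleEnergy_of_rows (hMono) (hCpt) (hReg) : ⟨S1pp, ideator v1.4 text `S1S2-sobolev-texts.v14.lean`
  sha16 adf1eba6, VERBATIM⟩` and ★★★ `uniformSmallScaleEnergy_band_of_rows` (the same with the registered band binder
  `Λ ≤ 21 →`, LEAD (c) «BAND PASS»; the ∀Λ text is proved, the binder is discarded).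
  Proof: a violating sequence `(U_j, r_j ↓ 0)`; (C) gives a minimising limit `U_∞` with `E(U_{φj}; B_ρ) → E(U_∞; B_ρ)`;
  (R) bounds the density of `U_∞` by `M` on the compact half-cube, so `E(U_∞; Q_ρ) ≤ 8ρ³(|M|+1)`; (M) and the sandwich
  `Q_r ⊆ B_{√3r}`, `B_ρ ⊆ Q_ρ` carry the bound down to the scales `r_j`: `ε < √3ρ⁻¹E(U_{φj}; B_ρ)`, hence in the limit
  `ε ≤ 8√3ρ²(|M|+1) ≤ ε∕2` for `ρ := min(½, ε∕(8√3(|M|+1)))` — contradiction.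
HONEST SCOPE.  A reduction: (M), (C), (R) are HYPOTHESES (printed theorems, to be vended as Literature named facts by a
typer); S1″ is NOT proved unconditionally here; S2♭″, `hHalvingBand`, K1, `MeanDeviationL`, `BlockLipschitzL`, `HistoryTailL`
are NOT proved.  YM₃ on T³ is rung R3, not Clay; YM gap NOT proved; no summit statement is proved here.

References: L. Simon, Theorems on Regularity and Singularity of Energy Minimizing Maps, Birkhäuser 1996 [Simon1996] (§2.1,
§2.4 (ii), §2.9 Lemma 1, §2.10 Cor. 1–2, §3.4); R. Schoen, K. Uhlenbeck, J. Differential Geom. 17 (1982) 307–335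
[SchoenUhlenbeck1982] (§2 monotonicity, §4 compactness); R. Schoen, K. Uhlenbeck, Invent. Math. 78 (1984) 89–100 [SchoenUhlenbeck1984] (Theorem,
`d(3) = 3`); S. Luckhaus, Indiana Univ. Math. J. 37 (1988) 349–367 [Luckhaus1988] (compactness theorem).
-/

set_option autoImplicit false

noncomputable section

open scoped BigOperators Topology
open MeasureTheory Set Filter Metric

namespace Summit.QuantumFields.YangMills.Theorems.PoincareLipschitzUniformSmallScaleEnergyOfRows

open Literature.Analysis.FunctionSpaces (HasWeakFDerivOn)
open Summit.QuantumFields.YangMills.Theorems.PoincareLipschitzSamplingCells (isOpen_absCube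
  isCompact_absCubeClosed volume_real_absCube)
open Summit.QuantumFields.YangMills.Theorems.PoincareLipschitzMinimiserBallBridge (absCube_subset_ball
  ball_subset_absCube closedBall_subset_unitCube energy_ball_le_of_cubeMin)

/-! ## S1″ from the three printed rows -/

/-- ★★★ **S1″ FROM THREE PRINTED ROWS.**  Uniform small-scale energy at the centre for finite-energy unit `W^{1,2}`
local minimisers `Q → S³ ⊂ ℝ⁴` of the Dirichlet energy (the v1.4 stub text `S1pp` of LINE 25 «CompactnessTransfer»,
token for token), from: (M) the MONOTONICITY of `ρ ↦ ρ⁻¹·E(B_ρ(y))` [Simon1996, §2.4 (ii)] [SchoenUhlenbeck1982, §2];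
(C) the COMPACTNESS THEOREM for energy minimising maps (subsequence, minimising limit, `L²_loc` convergence and
convergence of the energies on balls) [Luckhaus1988, compactness theorem] [Simon1996, §2.9 Lemma 1 and Remark (1)]; (R) INTERIOR
REGULARITY of energy minimising maps from 3-dimensional domains into `S³` (`n = 3 ≤ d(3) = 3`: no singular points, a
`C¹` — indeed real-analytic — representative whose classical gradient is the weak gradient) [SchoenUhlenbeck1984, Thm
(regularity for `n ≤ d(k)`)] [Simon1996, §2.10 Cor. 1–2].  All three rows are stated for maps that minimise on balls
`B̄_ρ(y) ⊂ Q` in the sense of [Simon1996, §2.1] (Sobolev phrasing: competitors are finite-energy unit `W^{1,2}(Q)` maps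
agreeing with the minimiser off a smaller concentric ball), to which S1″'s cube-competitor minimality reduces by
FILE 1's `energy_ball_le_of_cubeMin`.  Proof: a violating sequence `(U_j, r_j ↓ 0)`; (C) gives a minimising limit `U_∞` with
`E(U_j; B_ρ) → E(U_∞; B_ρ)`; (R) bounds the density of `U_∞` by `M` on `Q̄_{1∕2}`, so `E(U_∞; Q_ρ) ≤ 8ρ³(M+1)`; (M) and the
sandwich `Q_r ⊆ B_{√3 r}`, `B_ρ ⊆ Q_ρ` carry the bound down to the scales `r_j`: `ε < √3ρ⁻¹E(U_j;B_ρ) → ≤ 8√3ρ²(M+1) ≤ ε∕2`.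
[cite: Simon1996, §2.4 (ii), §2.9 Lemma 1, §2.10 Cor. 1; SchoenUhlenbeck1984, Theorem (n ≤ d(k)); Luckhaus1988, compactness theorem] -/
theorem uniformSmallScaleEnergy_of_rows
    (hMono : ∀ (hQ : IsOpen {x : EuclideanSpace ℝ (Fin 3) | ∀ i : Fin 3, |x i| < 1}) (U : EuclideanSpace ℝ (Fin 3) → EuclideanSpace ℝ (Fin 4)) (G : EuclideanSpace ℝ (Fin 3) → (EuclideanSpace ℝ (Fin 3) →L[ℝ] EuclideanSpace ℝ (Fin 4))),
      (HasWeakFDerivOn ⟨{x : EuclideanSpace ℝ (Fin 3) | ∀ i : Fin 3, |x i| < 1}, hQ⟩ volume U G ∧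
        (∀ x : EuclideanSpace ℝ (Fin 3), (∀ i : Fin 3, |x i| < 1) → ‖U x‖ = 1) ∧
        IntegrableOn (fun x => ∑ i : Fin 3, ‖G x (EuclideanSpace.single i (1:ℝ))‖ ^ 2) {x : EuclideanSpace ℝ (Fin 3) | ∀ i : Fin 3, |x i| < 1} ∧
        (∀ (y : EuclideanSpace ℝ (Fin 3)) (ρ : ℝ), 0 < ρ → closedBall y ρ ⊆ {x : EuclideanSpace ℝ (Fin 3) | ∀ i : Fin 3, |x i| < 1} →
          ∀ (W : EuclideanSpace ℝ (Fin 3) → EuclideanSpace ℝ (Fin 4)) (GW : EuclideanSpace ℝ (Fin 3) → (EuclideanSpace ℝ (Fin 3) →L[ℝ] EuclideanSpace ℝ (Fin 4))),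
          HasWeakFDerivOn ⟨{x : EuclideanSpace ℝ (Fin 3) | ∀ i : Fin 3, |x i| < 1}, hQ⟩ volume W GW →
          (∀ x : EuclideanSpace ℝ (Fin 3), (∀ i : Fin 3, |x i| < 1) → ‖W x‖ = 1) →
          IntegrableOn (fun x => ∑ i : Fin 3, ‖GW x (EuclideanSpace.single i (1:ℝ))‖ ^ 2) {x : EuclideanSpace ℝ (Fin 3) | ∀ i : Fin 3, |x i| < 1} →
          (∃ ρ' : ℝ, ρ' < ρ ∧ ∀ x : EuclideanSpace ℝ (Fin 3), x ∉ ball y ρ' → W x = U x) →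
          ∫ x in ball y ρ, ∑ i : Fin 3, ‖G x (EuclideanSpace.single i (1:ℝ))‖ ^ 2 ≤ ∫ x in ball y ρ, ∑ i : Fin 3, ‖GW x (EuclideanSpace.single i (1:ℝ))‖ ^ 2)) →
      ∀ (y : EuclideanSpace ℝ (Fin 3)) (σ ρ : ℝ), 0 < σ → σ ≤ ρ → closedBall y ρ ⊆ {x : EuclideanSpace ℝ (Fin 3) | ∀ i : Fin 3, |x i| < 1} →
        σ⁻¹ * ∫ x in ball y σ, ∑ i : Fin 3, ‖G x (EuclideanSpace.single i (1:ℝ))‖ ^ 2 ≤ ρ⁻¹ * ∫ x in ball y ρ, ∑ i : Fin 3, ‖G x (EuclideanSpace.single i (1:ℝ))‖ ^ 2)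
    (hCpt : ∀ (hQ : IsOpen {x : EuclideanSpace ℝ (Fin 3) | ∀ i : Fin 3, |x i| < 1}) (Λ : ℝ) (u : ℕ → EuclideanSpace ℝ (Fin 3) → EuclideanSpace ℝ (Fin 4)) (Gs : ℕ → EuclideanSpace ℝ (Fin 3) → (EuclideanSpace ℝ (Fin 3) →L[ℝ] EuclideanSpace ℝ (Fin 4))),
      (∀ j : ℕ, (HasWeakFDerivOn ⟨{x : EuclideanSpace ℝ (Fin 3) | ∀ i : Fin 3, |x i| < 1}, hQ⟩ volume (u j) (Gs j) ∧
        (∀ x : EuclideanSpace ℝ (Fin 3), (∀ i : Fin 3, |x i| < 1) → ‖(u j) x‖ = 1) ∧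
        IntegrableOn (fun x => ∑ i : Fin 3, ‖(Gs j) x (EuclideanSpace.single i (1:ℝ))‖ ^ 2) {x : EuclideanSpace ℝ (Fin 3) | ∀ i : Fin 3, |x i| < 1} ∧
        (∀ (y : EuclideanSpace ℝ (Fin 3)) (ρ : ℝ), 0 < ρ → closedBall y ρ ⊆ {x : EuclideanSpace ℝ (Fin 3) | ∀ i : Fin 3, |x i| < 1} →
          ∀ (W : EuclideanSpace ℝ (Fin 3) → EuclideanSpace ℝ (Fin 4)) (GW : EuclideanSpace ℝ (Fin 3) → (EuclideanSpace ℝ (Fin 3) →L[ℝ] EuclideanSpace ℝ (Fin 4))),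
          HasWeakFDerivOn ⟨{x : EuclideanSpace ℝ (Fin 3) | ∀ i : Fin 3, |x i| < 1}, hQ⟩ volume W GW →
          (∀ x : EuclideanSpace ℝ (Fin 3), (∀ i : Fin 3, |x i| < 1) → ‖W x‖ = 1) →
          IntegrableOn (fun x => ∑ i : Fin 3, ‖GW x (EuclideanSpace.single i (1:ℝ))‖ ^ 2) {x : EuclideanSpace ℝ (Fin 3) | ∀ i : Fin 3, |x i| < 1} →
          (∃ ρ' : ℝ, ρ' < ρ ∧ ∀ x : EuclideanSpace ℝ (Fin 3), x ∉ ball y ρ' → W x = (u j) x) →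
          ∫ x in ball y ρ, ∑ i : Fin 3, ‖(Gs j) x (EuclideanSpace.single i (1:ℝ))‖ ^ 2 ≤ ∫ x in ball y ρ, ∑ i : Fin 3, ‖GW x (EuclideanSpace.single i (1:ℝ))‖ ^ 2))) →
      (∀ j : ℕ, ∫ x in {x : EuclideanSpace ℝ (Fin 3) | ∀ i : Fin 3, |x i| < 1}, ∑ i : Fin 3, ‖(Gs j) x (EuclideanSpace.single i (1:ℝ))‖ ^ 2 ≤ Λ) →
      ∃ (U : EuclideanSpace ℝ (Fin 3) → EuclideanSpace ℝ (Fin 4)) (G : EuclideanSpace ℝ (Fin 3) → (EuclideanSpace ℝ (Fin 3) →L[ℝ] EuclideanSpace ℝ (Fin 4))) (φ : ℕ → ℕ), StrictMono φ ∧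
        (HasWeakFDerivOn ⟨{x : EuclideanSpace ℝ (Fin 3) | ∀ i : Fin 3, |x i| < 1}, hQ⟩ volume U G ∧
          (∀ x : EuclideanSpace ℝ (Fin 3), (∀ i : Fin 3, |x i| < 1) → ‖U x‖ = 1) ∧
          IntegrableOn (fun x => ∑ i : Fin 3, ‖G x (EuclideanSpace.single i (1:ℝ))‖ ^ 2) {x : EuclideanSpace ℝ (Fin 3) | ∀ i : Fin 3, |x i| < 1} ∧
          (∀ (y : EuclideanSpace ℝ (Fin 3)) (ρ : ℝ), 0 < ρ → closedBall y ρ ⊆ {x : EuclideanSpace ℝ (Fin 3) | ∀ i : Fin 3, |x i| < 1} →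
            ∀ (W : EuclideanSpace ℝ (Fin 3) → EuclideanSpace ℝ (Fin 4)) (GW : EuclideanSpace ℝ (Fin 3) → (EuclideanSpace ℝ (Fin 3) →L[ℝ] EuclideanSpace ℝ (Fin 4))),
            HasWeakFDerivOn ⟨{x : EuclideanSpace ℝ (Fin 3) | ∀ i : Fin 3, |x i| < 1}, hQ⟩ volume W GW →
            (∀ x : EuclideanSpace ℝ (Fin 3), (∀ i : Fin 3, |x i| < 1) → ‖W x‖ = 1) →
            IntegrableOn (fun x => ∑ i : Fin 3, ‖GW x (EuclideanSpace.single i (1:ℝ))‖ ^ 2) {x : EuclideanSpace ℝ (Fin 3) | ∀ i : Fin 3, |x i| < 1} →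
            (∃ ρ' : ℝ, ρ' < ρ ∧ ∀ x : EuclideanSpace ℝ (Fin 3), x ∉ ball y ρ' → W x = U x) →
            ∫ x in ball y ρ, ∑ i : Fin 3, ‖G x (EuclideanSpace.single i (1:ℝ))‖ ^ 2 ≤ ∫ x in ball y ρ, ∑ i : Fin 3, ‖GW x (EuclideanSpace.single i (1:ℝ))‖ ^ 2)) ∧
        (∀ (y : EuclideanSpace ℝ (Fin 3)) (ρ : ℝ), 0 < ρ → closedBall y ρ ⊆ {x : EuclideanSpace ℝ (Fin 3) | ∀ i : Fin 3, |x i| < 1} →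
          Tendsto (fun j : ℕ => ∫ x in ball y ρ, ‖u (φ j) x - U x‖ ^ 2) atTop (𝓝 0)) ∧
        (∀ (y : EuclideanSpace ℝ (Fin 3)) (ρ : ℝ), 0 < ρ → closedBall y ρ ⊆ {x : EuclideanSpace ℝ (Fin 3) | ∀ i : Fin 3, |x i| < 1} →
          Tendsto (fun j : ℕ => ∫ x in ball y ρ, ∑ i : Fin 3, ‖(Gs (φ j)) x (EuclideanSpace.single i (1:ℝ))‖ ^ 2) atTop
            (𝓝 (∫ x in ball y ρ, ∑ i : Fin 3, ‖G x (EuclideanSpace.single i (1:ℝ))‖ ^ 2))))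
    (hReg : ∀ (hQ : IsOpen {x : EuclideanSpace ℝ (Fin 3) | ∀ i : Fin 3, |x i| < 1}) (U : EuclideanSpace ℝ (Fin 3) → EuclideanSpace ℝ (Fin 4)) (G : EuclideanSpace ℝ (Fin 3) → (EuclideanSpace ℝ (Fin 3) →L[ℝ] EuclideanSpace ℝ (Fin 4))),
      (HasWeakFDerivOn ⟨{x : EuclideanSpace ℝ (Fin 3) | ∀ i : Fin 3, |x i| < 1}, hQ⟩ volume U G ∧
        (∀ x : EuclideanSpace ℝ (Fin 3), (∀ i : Fin 3, |x i| < 1) → ‖U x‖ = 1) ∧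
        IntegrableOn (fun x => ∑ i : Fin 3, ‖G x (EuclideanSpace.single i (1:ℝ))‖ ^ 2) {x : EuclideanSpace ℝ (Fin 3) | ∀ i : Fin 3, |x i| < 1} ∧
        (∀ (y : EuclideanSpace ℝ (Fin 3)) (ρ : ℝ), 0 < ρ → closedBall y ρ ⊆ {x : EuclideanSpace ℝ (Fin 3) | ∀ i : Fin 3, |x i| < 1} →
          ∀ (W : EuclideanSpace ℝ (Fin 3) → EuclideanSpace ℝ (Fin 4)) (GW : EuclideanSpace ℝ (Fin 3) → (EuclideanSpace ℝ (Fin 3) →L[ℝ] EuclideanSpace ℝ (Fin 4))),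
          HasWeakFDerivOn ⟨{x : EuclideanSpace ℝ (Fin 3) | ∀ i : Fin 3, |x i| < 1}, hQ⟩ volume W GW →
          (∀ x : EuclideanSpace ℝ (Fin 3), (∀ i : Fin 3, |x i| < 1) → ‖W x‖ = 1) →
          IntegrableOn (fun x => ∑ i : Fin 3, ‖GW x (EuclideanSpace.single i (1:ℝ))‖ ^ 2) {x : EuclideanSpace ℝ (Fin 3) | ∀ i : Fin 3, |x i| < 1} →
          (∃ ρ' : ℝ, ρ' < ρ ∧ ∀ x : EuclideanSpace ℝ (Fin 3), x ∉ ball y ρ' → W x = U x) →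
          ∫ x in ball y ρ, ∑ i : Fin 3, ‖G x (EuclideanSpace.single i (1:ℝ))‖ ^ 2 ≤ ∫ x in ball y ρ, ∑ i : Fin 3, ‖GW x (EuclideanSpace.single i (1:ℝ))‖ ^ 2)) →
      ∃ Ut : EuclideanSpace ℝ (Fin 3) → EuclideanSpace ℝ (Fin 4), ContDiffOn ℝ 1 Ut {x : EuclideanSpace ℝ (Fin 3) | ∀ i : Fin 3, |x i| < 1} ∧
        (∀ᵐ x ∂(volume.restrict {x : EuclideanSpace ℝ (Fin 3) | ∀ i : Fin 3, |x i| < 1}), Ut x = U x) ∧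
        (∀ᵐ x ∂(volume.restrict {x : EuclideanSpace ℝ (Fin 3) | ∀ i : Fin 3, |x i| < 1}), G x = fderiv ℝ Ut x)) :
    ∀ (Λ ε : ℝ), 0 < Λ → 0 < ε → ∃ r₁ : ℝ, 0 < r₁ ∧ r₁ ≤ 1 / 8 ∧
      ∀ (hQ : IsOpen {x : EuclideanSpace ℝ (Fin 3) | ∀ i : Fin 3, |x i| < 1}) (U : EuclideanSpace ℝ (Fin 3) → EuclideanSpace ℝ (Fin 4)) (G : EuclideanSpace ℝ (Fin 3) → (EuclideanSpace ℝ (Fin 3) →L[ℝ] EuclideanSpace ℝ (Fin 4))),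
      Literature.Analysis.FunctionSpaces.HasWeakFDerivOn ⟨{x : EuclideanSpace ℝ (Fin 3) | ∀ i : Fin 3, |x i| < 1}, hQ⟩ volume U G →
      (∀ x : EuclideanSpace ℝ (Fin 3), (∀ i : Fin 3, |x i| < 1) → ‖U x‖ = 1) →
      MeasureTheory.IntegrableOn (fun x => ∑ i : Fin 3, ‖G x (EuclideanSpace.single i (1:ℝ))‖ ^ 2)
        {x : EuclideanSpace ℝ (Fin 3) | ∀ i : Fin 3, |x i| < 1} →
      (∀ (V : EuclideanSpace ℝ (Fin 3) → EuclideanSpace ℝ (Fin 4)) (GV : EuclideanSpace ℝ (Fin 3) → (EuclideanSpace ℝ (Fin 3) →L[ℝ] EuclideanSpace ℝ (Fin 4))) (s : ℝ), s < 1 →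
        Literature.Analysis.FunctionSpaces.HasWeakFDerivOn ⟨{x : EuclideanSpace ℝ (Fin 3) | ∀ i : Fin 3, |x i| < 1}, hQ⟩ volume V GV →
        (∀ x : EuclideanSpace ℝ (Fin 3), (∀ i : Fin 3, |x i| < 1) → ‖V x‖ = 1) →
        MeasureTheory.IntegrableOn (fun x => ∑ i : Fin 3, ‖GV x (EuclideanSpace.single i (1:ℝ))‖ ^ 2)
        {x : EuclideanSpace ℝ (Fin 3) | ∀ i : Fin 3, |x i| < 1} →
        (∀ x : EuclideanSpace ℝ (Fin 3), (∃ i : Fin 3, s ≤ |x i|) → V x = U x) →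
        ∫ x in {x : EuclideanSpace ℝ (Fin 3) | ∀ i : Fin 3, |x i| < 1}, ∑ i : Fin 3, ‖G x (EuclideanSpace.single i (1:ℝ))‖ ^ 2 ≤
          ∫ x in {x : EuclideanSpace ℝ (Fin 3) | ∀ i : Fin 3, |x i| < 1}, ∑ i : Fin 3, ‖GV x (EuclideanSpace.single i (1:ℝ))‖ ^ 2) →
      ∫ x in {x : EuclideanSpace ℝ (Fin 3) | ∀ i : Fin 3, |x i| < 1}, ∑ i : Fin 3, ‖G x (EuclideanSpace.single i (1:ℝ))‖ ^ 2 ≤ Λ →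
      ∀ r : ℝ, 0 < r → r ≤ r₁ →
        ∫ x in {x : EuclideanSpace ℝ (Fin 3) | ∀ i : Fin 3, |x i| < r}, ∑ i : Fin 3, ‖G x (EuclideanSpace.single i (1:ℝ))‖ ^ 2 ≤ ε * r := by
  intro Λ ε hΛ hε
  by_contra hcon
  push Not at hcon
  have hQ : IsOpen {x : EuclideanSpace ℝ (Fin 3) | ∀ i : Fin 3, |x i| < 1} := isOpen_absCube 1
  -- a violating sequence at the radii `r₁ := 1∕(8(j+1))`
  have hr1pos : ∀ j : ℕ, (0 : ℝ) < 1 / (8 * ((j : ℝ) + 1)) := fun j => by positivity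
  have hr1le : ∀ j : ℕ, 1 / (8 * ((j : ℝ) + 1)) ≤ (1 : ℝ) / 8 := fun j =>
    one_div_le_one_div_of_le (by norm_num) (by nlinarith [(Nat.cast_nonneg j : (0 : ℝ) ≤ j)])
  choose hQf Uf Gf hWDf hUnitf hIntf hMinf hEf rf hr0f hrlef hεrf using hcon
  -- the sequence
  set u : ℕ → EuclideanSpace ℝ (Fin 3) → EuclideanSpace ℝ (Fin 4) := fun j => Uf _ (hr1pos j) (hr1le j) with hu_def
  set Gs : ℕ → EuclideanSpace ℝ (Fin 3) → (EuclideanSpace ℝ (Fin 3) →L[ℝ] EuclideanSpace ℝ (Fin 4)) :=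
    fun j => Gf _ (hr1pos j) (hr1le j) with hGs_def
  set r : ℕ → ℝ := fun j => rf _ (hr1pos j) (hr1le j) with hr_def
  have hWD : ∀ j : ℕ, HasWeakFDerivOn ⟨{x : EuclideanSpace ℝ (Fin 3) | ∀ i : Fin 3, |x i| < 1}, hQ⟩ volume (u j) (Gs j) :=
    fun j => hWDf _ (hr1pos j) (hr1le j)
  have hSMin : ∀ j : ℕ, (HasWeakFDerivOn ⟨{x : EuclideanSpace ℝ (Fin 3) | ∀ i : Fin 3, |x i| < 1}, hQ⟩ volume (u j) (Gs j) ∧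
      (∀ x : EuclideanSpace ℝ (Fin 3), (∀ i : Fin 3, |x i| < 1) → ‖(u j) x‖ = 1) ∧
      IntegrableOn (fun x => ∑ i : Fin 3, ‖(Gs j) x (EuclideanSpace.single i (1:ℝ))‖ ^ 2) {x : EuclideanSpace ℝ (Fin 3) | ∀ i : Fin 3, |x i| < 1} ∧
      (∀ (y : EuclideanSpace ℝ (Fin 3)) (ρ : ℝ), 0 < ρ → closedBall y ρ ⊆ {x : EuclideanSpace ℝ (Fin 3) | ∀ i : Fin 3, |x i| < 1} →
        ∀ (W : EuclideanSpace ℝ (Fin 3) → EuclideanSpace ℝ (Fin 4))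
          (GW : EuclideanSpace ℝ (Fin 3) → (EuclideanSpace ℝ (Fin 3) →L[ℝ] EuclideanSpace ℝ (Fin 4))),
        HasWeakFDerivOn ⟨{x : EuclideanSpace ℝ (Fin 3) | ∀ i : Fin 3, |x i| < 1}, hQ⟩ volume W GW →
        (∀ x : EuclideanSpace ℝ (Fin 3), (∀ i : Fin 3, |x i| < 1) → ‖W x‖ = 1) →
        IntegrableOn (fun x => ∑ i : Fin 3, ‖GW x (EuclideanSpace.single i (1:ℝ))‖ ^ 2) {x : EuclideanSpace ℝ (Fin 3) | ∀ i : Fin 3, |x i| < 1} →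
        (∃ ρ' : ℝ, ρ' < ρ ∧ ∀ x : EuclideanSpace ℝ (Fin 3), x ∉ ball y ρ' → W x = (u j) x) →
        ∫ x in ball y ρ, ∑ i : Fin 3, ‖(Gs j) x (EuclideanSpace.single i (1:ℝ))‖ ^ 2 ≤
          ∫ x in ball y ρ, ∑ i : Fin 3, ‖GW x (EuclideanSpace.single i (1:ℝ))‖ ^ 2)) := fun j =>
    ⟨hWD j, hUnitf _ (hr1pos j) (hr1le j), hIntf _ (hr1pos j) (hr1le j),
      fun y ρ hρ hyρ W GW hW hW1 hGWi hWU =>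
        energy_ball_le_of_cubeMin hQ (u j) (Gs j) (hWD j) (hIntf _ (hr1pos j) (hr1le j))
          (hMinf _ (hr1pos j) (hr1le j)) y ρ hρ hyρ W GW hW hW1 hGWi hWU⟩
  have hE : ∀ j : ℕ, ∫ x in {x : EuclideanSpace ℝ (Fin 3) | ∀ i : Fin 3, |x i| < 1}, ∑ i : Fin 3, ‖(Gs j) x (EuclideanSpace.single i (1:ℝ))‖ ^ 2 ≤ Λ :=
    fun j => hEf _ (hr1pos j) (hr1le j)
  -- (C): a minimising limit with convergent ball energies
  obtain ⟨U, G, φ, hφ, hSMinU, -, hEn⟩ := hCpt hQ Λ u Gs hSMin hE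
  -- (R): a `C¹` representative of the limit; its density is bounded on the compact half cube
  obtain ⟨Ut, hUt, -, hGae⟩ := hReg hQ U G hSMinU
  have hKc : IsCompact {x : EuclideanSpace ℝ (Fin 3) | ∀ i : Fin 3, |x i| ≤ 1 / 2} :=
    isCompact_absCubeClosed (by norm_num)
  have hKQ : {x : EuclideanSpace ℝ (Fin 3) | ∀ i : Fin 3, |x i| ≤ 1 / 2} ⊆ {x : EuclideanSpace ℝ (Fin 3) | ∀ i : Fin 3, |x i| < 1} :=
    fun x hx i => lt_of_le_of_lt (hx i) (by norm_num)
  have hcont : ContinuousOn (fun x => fderiv ℝ Ut x) {x : EuclideanSpace ℝ (Fin 3) | ∀ i : Fin 3, |x i| < 1} := hUt.continuousOn_fderiv_of_isOpen hQ le_rfl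
  have hdcont : ContinuousOn (fun x => ∑ i : Fin 3, ‖fderiv ℝ Ut x (EuclideanSpace.single i (1:ℝ))‖ ^ 2) {x : EuclideanSpace ℝ (Fin 3) | ∀ i : Fin 3, |x i| < 1} := by
    refine continuousOn_finsetSum _ fun i _ => ?_
    exact ((hcont.clm_apply continuousOn_const).norm).pow 2
  obtain ⟨M, hM⟩ : ∃ M : ℝ, ∀ x ∈ {x : EuclideanSpace ℝ (Fin 3) | ∀ i : Fin 3, |x i| ≤ 1 / 2},
      ∑ i : Fin 3, ‖fderiv ℝ Ut x (EuclideanSpace.single i (1:ℝ))‖ ^ 2 ≤ M := by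
    obtain ⟨M, hM⟩ := hKc.bddAbove_image (hdcont.mono hKQ)
    exact ⟨M, fun x hx => hM (mem_image_of_mem _ hx)⟩
  -- the comparison radius `ρ`
  set c : ℝ := 8 * Real.sqrt 3 * (|M| + 1) with hc_def
  have hc : 0 < c := by positivity
  set ρ : ℝ := min (1 / 2) (ε / c) with hρ_def
  have hρpos : 0 < ρ := lt_min (by norm_num) (div_pos hε hc)
  have hρhalf : ρ ≤ 1 / 2 := min_le_left _ _
  have hρc : ρ * c ≤ ε := by
    have h := min_le_right (1 / 2 : ℝ) (ε / c)
    rwa [← hρ_def, le_div_iff₀ hc] at h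
  have hρ1 : ρ < 1 := by linarith
  have hBQ : closedBall (0 : EuclideanSpace ℝ (Fin 3)) ρ ⊆ {x : EuclideanSpace ℝ (Fin 3) | ∀ i : Fin 3, |x i| < 1} := closedBall_subset_unitCube hρ1
  -- the limit's energy on `B(0, ρ)` is at most `8ρ³(|M|+1)`
  have hGi : IntegrableOn (fun x => ∑ i : Fin 3, ‖G x (EuclideanSpace.single i (1:ℝ))‖ ^ 2) {x : EuclideanSpace ℝ (Fin 3) | ∀ i : Fin 3, |x i| < 1} := hSMinU.2.2.1
  have hQρQ : {x : EuclideanSpace ℝ (Fin 3) | ∀ i : Fin 3, |x i| < ρ} ⊆ {x : EuclideanSpace ℝ (Fin 3) | ∀ i : Fin 3, |x i| < 1} := fun x hx i => (hx i).trans hρ1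
  have hQρK : {x : EuclideanSpace ℝ (Fin 3) | ∀ i : Fin 3, |x i| < ρ} ⊆
      {x : EuclideanSpace ℝ (Fin 3) | ∀ i : Fin 3, |x i| ≤ 1 / 2} := fun x hx i => (hx i).le.trans hρhalf
  have hdi : IntegrableOn (fun x => ∑ i : Fin 3, ‖fderiv ℝ Ut x (EuclideanSpace.single i (1:ℝ))‖ ^ 2)
      {x : EuclideanSpace ℝ (Fin 3) | ∀ i : Fin 3, |x i| < ρ} := by
    refine (hGi.mono_set hQρQ).congr_fun_ae ?_
    have h := ae_restrict_of_ae_restrict_of_subset hQρQ hGae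
    filter_upwards [h] with x hx
    simp only [hx]
  have hlimE : ∫ x in ball (0 : EuclideanSpace ℝ (Fin 3)) ρ, ∑ i : Fin 3, ‖G x (EuclideanSpace.single i (1:ℝ))‖ ^ 2 ≤
      8 * ρ ^ 3 * (|M| + 1) := by
    calc ∫ x in ball (0 : EuclideanSpace ℝ (Fin 3)) ρ, ∑ i : Fin 3, ‖G x (EuclideanSpace.single i (1:ℝ))‖ ^ 2
        ≤ ∫ x in {x : EuclideanSpace ℝ (Fin 3) | ∀ i : Fin 3, |x i| < ρ}, ∑ i : Fin 3, ‖G x (EuclideanSpace.single i (1:ℝ))‖ ^ 2 :=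
          setIntegral_mono_set (hGi.mono_set hQρQ) (Eventually.of_forall fun x => Finset.sum_nonneg fun i _ => by positivity)
            (Eventually.of_forall (ball_subset_absCube ρ))
      _ = ∫ x in {x : EuclideanSpace ℝ (Fin 3) | ∀ i : Fin 3, |x i| < ρ},
            ∑ i : Fin 3, ‖fderiv ℝ Ut x (EuclideanSpace.single i (1:ℝ))‖ ^ 2 := by
          refine integral_congr_ae ?_
          have h := ae_restrict_of_ae_restrict_of_subset hQρQ hGae
          filter_upwards [h] with x hx
          simp only [hx]
      _ ≤ ∫ x in {x : EuclideanSpace ℝ (Fin 3) | ∀ i : Fin 3, |x i| < ρ}, (|M| + 1 : ℝ) := by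
          refine setIntegral_mono_on hdi ?_ (isOpen_absCube ρ).measurableSet fun x hx => ?_
          · rw [IntegrableOn]
            have : volume {x : EuclideanSpace ℝ (Fin 3) | ∀ i : Fin 3, |x i| < ρ} < ⊤ :=
              lt_of_le_of_lt (measure_mono hQρK) hKc.measure_lt_top
            exact integrableOn_const (μ := volume) this.ne
          · exact (hM x (hQρK hx)).trans (by linarith [le_abs_self M])
      _ = 8 * ρ ^ 3 * (|M| + 1) := by
          rw [setIntegral_const, Measure.real, volume_real_absCube hρpos.le, smul_eq_mul]
  -- eventually the violating scales `√3·r_{φ j}` are below `ρ`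
  obtain ⟨N, hN⟩ : ∃ N : ℕ, Real.sqrt 3 / (8 * ρ) ≤ (N : ℝ) + 1 := by
    obtain ⟨N, hN⟩ := exists_nat_ge (Real.sqrt 3 / (8 * ρ))
    exact ⟨N, hN.trans (by linarith)⟩
  have hev : ∀ᶠ j : ℕ in atTop, ε ≤ (Real.sqrt 3 / ρ) *
      ∫ x in ball (0 : EuclideanSpace ℝ (Fin 3)) ρ, ∑ i : Fin 3, ‖(Gs (φ j)) x (EuclideanSpace.single i (1:ℝ))‖ ^ 2 := by
    filter_upwards [eventually_ge_atTop N] with j hj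
    -- the scale
    have hr0 : 0 < r (φ j) := hr0f _ (hr1pos (φ j)) (hr1le (φ j))
    have hrle : r (φ j) ≤ 1 / (8 * (((φ j : ℕ) : ℝ) + 1)) := hrlef _ (hr1pos (φ j)) (hr1le (φ j))
    have hφj : (j : ℝ) ≤ ((φ j : ℕ) : ℝ) := by exact_mod_cast hφ.id_le j
    have hNj : (N : ℝ) ≤ (j : ℝ) := by exact_mod_cast hj
    have h3 : (0 : ℝ) < Real.sqrt 3 := Real.sqrt_pos.mpr (by norm_num)
    have hσρ : Real.sqrt 3 * r (φ j) ≤ ρ := by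
      have h1 : Real.sqrt 3 * r (φ j) ≤ Real.sqrt 3 * (1 / (8 * (((φ j : ℕ) : ℝ) + 1))) :=
        mul_le_mul_of_nonneg_left hrle h3.le
      have h2 : Real.sqrt 3 * (1 / (8 * (((φ j : ℕ) : ℝ) + 1))) ≤ ρ := by
        rw [mul_one_div, div_le_iff₀ (by positivity)]
        have h4 : Real.sqrt 3 ≤ ((N : ℝ) + 1) * (8 * ρ) := by rwa [div_le_iff₀ (by positivity)] at hN
        nlinarith
      exact h1.trans h2
    have hσ0 : 0 < Real.sqrt 3 * r (φ j) := mul_pos h3 hr0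
    -- cube below the ball, ball monotonicity
    have hballQ : ball (0 : EuclideanSpace ℝ (Fin 3)) (Real.sqrt 3 * r (φ j)) ⊆ {x : EuclideanSpace ℝ (Fin 3) | ∀ i : Fin 3, |x i| < 1} :=
      (ball_subset_closedBall.trans (closedBall_subset_closedBall hσρ)).trans hBQ
    have hGji : IntegrableOn (fun x => ∑ i : Fin 3, ‖(Gs (φ j)) x (EuclideanSpace.single i (1:ℝ))‖ ^ 2) {x : EuclideanSpace ℝ (Fin 3) | ∀ i : Fin 3, |x i| < 1} :=
      (hSMin (φ j)).2.2.1
    have hcube : ∫ x in {x : EuclideanSpace ℝ (Fin 3) | ∀ i : Fin 3, |x i| < r (φ j)},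
          ∑ i : Fin 3, ‖(Gs (φ j)) x (EuclideanSpace.single i (1:ℝ))‖ ^ 2 ≤
        ∫ x in ball (0 : EuclideanSpace ℝ (Fin 3)) (Real.sqrt 3 * r (φ j)),
          ∑ i : Fin 3, ‖(Gs (φ j)) x (EuclideanSpace.single i (1:ℝ))‖ ^ 2 :=
      setIntegral_mono_set (hGji.mono_set hballQ) (Eventually.of_forall fun x => Finset.sum_nonneg fun i _ => by positivity)
        (Eventually.of_forall (absCube_subset_ball hr0))
    have hmono := hMono hQ (u (φ j)) (Gs (φ j)) (hSMin (φ j)) 0 (Real.sqrt 3 * r (φ j)) ρ hσ0 hσρ hBQ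
    have hviol : ε * r (φ j) < ∫ x in {x : EuclideanSpace ℝ (Fin 3) | ∀ i : Fin 3, |x i| < r (φ j)},
        ∑ i : Fin 3, ‖(Gs (φ j)) x (EuclideanSpace.single i (1:ℝ))‖ ^ 2 := hεrf _ (hr1pos (φ j)) (hr1le (φ j))
    -- `ε·r < E(Q_r) ≤ E(B_{√3 r}) ≤ (√3 r ∕ ρ)·E(B_ρ)`
    set Eσ := ∫ x in ball (0 : EuclideanSpace ℝ (Fin 3)) (Real.sqrt 3 * r (φ j)),
          ∑ i : Fin 3, ‖(Gs (φ j)) x (EuclideanSpace.single i (1:ℝ))‖ ^ 2 with hEσ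
    set Eρ := ∫ x in ball (0 : EuclideanSpace ℝ (Fin 3)) ρ,
          ∑ i : Fin 3, ‖(Gs (φ j)) x (EuclideanSpace.single i (1:ℝ))‖ ^ 2 with hEρ
    have hEρ0 : 0 ≤ Eρ := setIntegral_nonneg measurableSet_ball fun x _ => Finset.sum_nonneg fun i _ => by positivity
    have hkey : Eσ ≤ Real.sqrt 3 * r (φ j) * (ρ⁻¹ * Eρ) := by
      have h := mul_le_mul_of_nonneg_left hmono hσ0.le
      rwa [← mul_assoc, mul_inv_cancel₀ hσ0.ne', one_mul] at h
    have h5 : ε * r (φ j) < r (φ j) * (Real.sqrt 3 / ρ * Eρ) := by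
      calc ε * r (φ j) < Eσ := hviol.trans_le hcube
        _ ≤ Real.sqrt 3 * r (φ j) * (ρ⁻¹ * Eρ) := hkey
        _ = r (φ j) * (Real.sqrt 3 / ρ * Eρ) := by rw [div_eq_mul_inv]; ring
    exact (lt_of_mul_lt_mul_left (by rw [mul_comm]; exact h5) hr0.le).le
  -- pass to the limit along `φ` and conclude
  have hεle : ε ≤ (Real.sqrt 3 / ρ) *
      ∫ x in ball (0 : EuclideanSpace ℝ (Fin 3)) ρ, ∑ i : Fin 3, ‖G x (EuclideanSpace.single i (1:ℝ))‖ ^ 2 :=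
    ge_of_tendsto ((hEn 0 ρ hρpos hBQ).const_mul (Real.sqrt 3 / ρ)) hev
  have h3 : (0 : ℝ) < Real.sqrt 3 := Real.sqrt_pos.mpr (by norm_num)
  have hfin : ε ≤ ρ * (ρ * c) := by
    calc ε ≤ (Real.sqrt 3 / ρ) * (8 * ρ ^ 3 * (|M| + 1)) :=
          hεle.trans (mul_le_mul_of_nonneg_left hlimE (div_nonneg h3.le hρpos.le))
      _ = ρ * (ρ * c) := by rw [hc_def]; field_simp
  have hfin2 : ρ * (ρ * c) ≤ (1 / 2) * ε :=
    mul_le_mul hρhalf hρc (mul_nonneg hρpos.le hc.le) (by norm_num)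
  linarith


/-- ★★★ **S1″-BAND FROM THE THREE PRINTED ROWS** — the registered v1.4-band text of `stub_uniformSmallScaleEnergy` (LEAD ★w1-19936
g10 (c) «BAND PASS»: the extra binder `Λ ≤ 21 →`), VERBATIM; the binder is discarded, the `∀Λ` theorem
`uniformSmallScaleEnergy_of_rows` does the work. [cite: Simon1996, §2.4 (ii), §2.9 Lemma 1, §2.10 Cor. 1; SchoenUhlenbeck1984, Theorem (n ≤ d(k)); Luckhaus1988, compactness theorem] -/
theorem uniformSmallScaleEnergy_band_of_rows
    (hMono : ∀ (hQ : IsOpen {x : EuclideanSpace ℝ (Fin 3) | ∀ i : Fin 3, |x i| < 1}) (U : EuclideanSpace ℝ (Fin 3) → EuclideanSpace ℝ (Fin 4)) (G : EuclideanSpace ℝ (Fin 3) → (EuclideanSpace ℝ (Fin 3) →L[ℝ] EuclideanSpace ℝ (Fin 4))),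
      (HasWeakFDerivOn ⟨{x : EuclideanSpace ℝ (Fin 3) | ∀ i : Fin 3, |x i| < 1}, hQ⟩ volume U G ∧
        (∀ x : EuclideanSpace ℝ (Fin 3), (∀ i : Fin 3, |x i| < 1) → ‖U x‖ = 1) ∧
        IntegrableOn (fun x => ∑ i : Fin 3, ‖G x (EuclideanSpace.single i (1:ℝ))‖ ^ 2) {x : EuclideanSpace ℝ (Fin 3) | ∀ i : Fin 3, |x i| < 1} ∧
        (∀ (y : EuclideanSpace ℝ (Fin 3)) (ρ : ℝ), 0 < ρ → closedBall y ρ ⊆ {x : EuclideanSpace ℝ (Fin 3) | ∀ i : Fin 3, |x i| < 1} →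
          ∀ (W : EuclideanSpace ℝ (Fin 3) → EuclideanSpace ℝ (Fin 4)) (GW : EuclideanSpace ℝ (Fin 3) → (EuclideanSpace ℝ (Fin 3) →L[ℝ] EuclideanSpace ℝ (Fin 4))),
          HasWeakFDerivOn ⟨{x : EuclideanSpace ℝ (Fin 3) | ∀ i : Fin 3, |x i| < 1}, hQ⟩ volume W GW →
          (∀ x : EuclideanSpace ℝ (Fin 3), (∀ i : Fin 3, |x i| < 1) → ‖W x‖ = 1) →
          IntegrableOn (fun x => ∑ i : Fin 3, ‖GW x (EuclideanSpace.single i (1:ℝ))‖ ^ 2) {x : EuclideanSpace ℝ (Fin 3) | ∀ i : Fin 3, |x i| < 1} →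
          (∃ ρ' : ℝ, ρ' < ρ ∧ ∀ x : EuclideanSpace ℝ (Fin 3), x ∉ ball y ρ' → W x = U x) →
          ∫ x in ball y ρ, ∑ i : Fin 3, ‖G x (EuclideanSpace.single i (1:ℝ))‖ ^ 2 ≤ ∫ x in ball y ρ, ∑ i : Fin 3, ‖GW x (EuclideanSpace.single i (1:ℝ))‖ ^ 2)) →
      ∀ (y : EuclideanSpace ℝ (Fin 3)) (σ ρ : ℝ), 0 < σ → σ ≤ ρ → closedBall y ρ ⊆ {x : EuclideanSpace ℝ (Fin 3) | ∀ i : Fin 3, |x i| < 1} →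
        σ⁻¹ * ∫ x in ball y σ, ∑ i : Fin 3, ‖G x (EuclideanSpace.single i (1:ℝ))‖ ^ 2 ≤ ρ⁻¹ * ∫ x in ball y ρ, ∑ i : Fin 3, ‖G x (EuclideanSpace.single i (1:ℝ))‖ ^ 2)
    (hCpt : ∀ (hQ : IsOpen {x : EuclideanSpace ℝ (Fin 3) | ∀ i : Fin 3, |x i| < 1}) (Λ : ℝ) (u : ℕ → EuclideanSpace ℝ (Fin 3) → EuclideanSpace ℝ (Fin 4)) (Gs : ℕ → EuclideanSpace ℝ (Fin 3) → (EuclideanSpace ℝ (Fin 3) →L[ℝ] EuclideanSpace ℝ (Fin 4))),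
      (∀ j : ℕ, (HasWeakFDerivOn ⟨{x : EuclideanSpace ℝ (Fin 3) | ∀ i : Fin 3, |x i| < 1}, hQ⟩ volume (u j) (Gs j) ∧
        (∀ x : EuclideanSpace ℝ (Fin 3), (∀ i : Fin 3, |x i| < 1) → ‖(u j) x‖ = 1) ∧
        IntegrableOn (fun x => ∑ i : Fin 3, ‖(Gs j) x (EuclideanSpace.single i (1:ℝ))‖ ^ 2) {x : EuclideanSpace ℝ (Fin 3) | ∀ i : Fin 3, |x i| < 1} ∧
        (∀ (y : EuclideanSpace ℝ (Fin 3)) (ρ : ℝ), 0 < ρ → closedBall y ρ ⊆ {x : EuclideanSpace ℝ (Fin 3) | ∀ i : Fin 3, |x i| < 1} →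
          ∀ (W : EuclideanSpace ℝ (Fin 3) → EuclideanSpace ℝ (Fin 4)) (GW : EuclideanSpace ℝ (Fin 3) → (EuclideanSpace ℝ (Fin 3) →L[ℝ] EuclideanSpace ℝ (Fin 4))),
          HasWeakFDerivOn ⟨{x : EuclideanSpace ℝ (Fin 3) | ∀ i : Fin 3, |x i| < 1}, hQ⟩ volume W GW →
          (∀ x : EuclideanSpace ℝ (Fin 3), (∀ i : Fin 3, |x i| < 1) → ‖W x‖ = 1) →
          IntegrableOn (fun x => ∑ i : Fin 3, ‖GW x (EuclideanSpace.single i (1:ℝ))‖ ^ 2) {x : EuclideanSpace ℝ (Fin 3) | ∀ i : Fin 3, |x i| < 1} →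
          (∃ ρ' : ℝ, ρ' < ρ ∧ ∀ x : EuclideanSpace ℝ (Fin 3), x ∉ ball y ρ' → W x = (u j) x) →
          ∫ x in ball y ρ, ∑ i : Fin 3, ‖(Gs j) x (EuclideanSpace.single i (1:ℝ))‖ ^ 2 ≤ ∫ x in ball y ρ, ∑ i : Fin 3, ‖GW x (EuclideanSpace.single i (1:ℝ))‖ ^ 2))) →
      (∀ j : ℕ, ∫ x in {x : EuclideanSpace ℝ (Fin 3) | ∀ i : Fin 3, |x i| < 1}, ∑ i : Fin 3, ‖(Gs j) x (EuclideanSpace.single i (1:ℝ))‖ ^ 2 ≤ Λ) →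
      ∃ (U : EuclideanSpace ℝ (Fin 3) → EuclideanSpace ℝ (Fin 4)) (G : EuclideanSpace ℝ (Fin 3) → (EuclideanSpace ℝ (Fin 3) →L[ℝ] EuclideanSpace ℝ (Fin 4))) (φ : ℕ → ℕ), StrictMono φ ∧
        (HasWeakFDerivOn ⟨{x : EuclideanSpace ℝ (Fin 3) | ∀ i : Fin 3, |x i| < 1}, hQ⟩ volume U G ∧
          (∀ x : EuclideanSpace ℝ (Fin 3), (∀ i : Fin 3, |x i| < 1) → ‖U x‖ = 1) ∧
          IntegrableOn (fun x => ∑ i : Fin 3, ‖G x (EuclideanSpace.single i (1:ℝ))‖ ^ 2) {x : EuclideanSpace ℝ (Fin 3) | ∀ i : Fin 3, |x i| < 1} ∧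
          (∀ (y : EuclideanSpace ℝ (Fin 3)) (ρ : ℝ), 0 < ρ → closedBall y ρ ⊆ {x : EuclideanSpace ℝ (Fin 3) | ∀ i : Fin 3, |x i| < 1} →
            ∀ (W : EuclideanSpace ℝ (Fin 3) → EuclideanSpace ℝ (Fin 4)) (GW : EuclideanSpace ℝ (Fin 3) → (EuclideanSpace ℝ (Fin 3) →L[ℝ] EuclideanSpace ℝ (Fin 4))),
            HasWeakFDerivOn ⟨{x : EuclideanSpace ℝ (Fin 3) | ∀ i : Fin 3, |x i| < 1}, hQ⟩ volume W GW →
            (∀ x : EuclideanSpace ℝ (Fin 3), (∀ i : Fin 3, |x i| < 1) → ‖W x‖ = 1) →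
            IntegrableOn (fun x => ∑ i : Fin 3, ‖GW x (EuclideanSpace.single i (1:ℝ))‖ ^ 2) {x : EuclideanSpace ℝ (Fin 3) | ∀ i : Fin 3, |x i| < 1} →
            (∃ ρ' : ℝ, ρ' < ρ ∧ ∀ x : EuclideanSpace ℝ (Fin 3), x ∉ ball y ρ' → W x = U x) →
            ∫ x in ball y ρ, ∑ i : Fin 3, ‖G x (EuclideanSpace.single i (1:ℝ))‖ ^ 2 ≤ ∫ x in ball y ρ, ∑ i : Fin 3, ‖GW x (EuclideanSpace.single i (1:ℝ))‖ ^ 2)) ∧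
        (∀ (y : EuclideanSpace ℝ (Fin 3)) (ρ : ℝ), 0 < ρ → closedBall y ρ ⊆ {x : EuclideanSpace ℝ (Fin 3) | ∀ i : Fin 3, |x i| < 1} →
          Tendsto (fun j : ℕ => ∫ x in ball y ρ, ‖u (φ j) x - U x‖ ^ 2) atTop (𝓝 0)) ∧
        (∀ (y : EuclideanSpace ℝ (Fin 3)) (ρ : ℝ), 0 < ρ → closedBall y ρ ⊆ {x : EuclideanSpace ℝ (Fin 3) | ∀ i : Fin 3, |x i| < 1} →
          Tendsto (fun j : ℕ => ∫ x in ball y ρ, ∑ i : Fin 3, ‖(Gs (φ j)) x (EuclideanSpace.single i (1:ℝ))‖ ^ 2) atTop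
            (𝓝 (∫ x in ball y ρ, ∑ i : Fin 3, ‖G x (EuclideanSpace.single i (1:ℝ))‖ ^ 2))))
    (hReg : ∀ (hQ : IsOpen {x : EuclideanSpace ℝ (Fin 3) | ∀ i : Fin 3, |x i| < 1}) (U : EuclideanSpace ℝ (Fin 3) → EuclideanSpace ℝ (Fin 4)) (G : EuclideanSpace ℝ (Fin 3) → (EuclideanSpace ℝ (Fin 3) →L[ℝ] EuclideanSpace ℝ (Fin 4))),
      (HasWeakFDerivOn ⟨{x : EuclideanSpace ℝ (Fin 3) | ∀ i : Fin 3, |x i| < 1}, hQ⟩ volume U G ∧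
        (∀ x : EuclideanSpace ℝ (Fin 3), (∀ i : Fin 3, |x i| < 1) → ‖U x‖ = 1) ∧
        IntegrableOn (fun x => ∑ i : Fin 3, ‖G x (EuclideanSpace.single i (1:ℝ))‖ ^ 2) {x : EuclideanSpace ℝ (Fin 3) | ∀ i : Fin 3, |x i| < 1} ∧
        (∀ (y : EuclideanSpace ℝ (Fin 3)) (ρ : ℝ), 0 < ρ → closedBall y ρ ⊆ {x : EuclideanSpace ℝ (Fin 3) | ∀ i : Fin 3, |x i| < 1} →
          ∀ (W : EuclideanSpace ℝ (Fin 3) → EuclideanSpace ℝ (Fin 4)) (GW : EuclideanSpace ℝ (Fin 3) → (EuclideanSpace ℝ (Fin 3) →L[ℝ] EuclideanSpace ℝ (Fin 4))),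
          HasWeakFDerivOn ⟨{x : EuclideanSpace ℝ (Fin 3) | ∀ i : Fin 3, |x i| < 1}, hQ⟩ volume W GW →
          (∀ x : EuclideanSpace ℝ (Fin 3), (∀ i : Fin 3, |x i| < 1) → ‖W x‖ = 1) →
          IntegrableOn (fun x => ∑ i : Fin 3, ‖GW x (EuclideanSpace.single i (1:ℝ))‖ ^ 2) {x : EuclideanSpace ℝ (Fin 3) | ∀ i : Fin 3, |x i| < 1} →
          (∃ ρ' : ℝ, ρ' < ρ ∧ ∀ x : EuclideanSpace ℝ (Fin 3), x ∉ ball y ρ' → W x = U x) →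
          ∫ x in ball y ρ, ∑ i : Fin 3, ‖G x (EuclideanSpace.single i (1:ℝ))‖ ^ 2 ≤ ∫ x in ball y ρ, ∑ i : Fin 3, ‖GW x (EuclideanSpace.single i (1:ℝ))‖ ^ 2)) →
      ∃ Ut : EuclideanSpace ℝ (Fin 3) → EuclideanSpace ℝ (Fin 4), ContDiffOn ℝ 1 Ut {x : EuclideanSpace ℝ (Fin 3) | ∀ i : Fin 3, |x i| < 1} ∧
        (∀ᵐ x ∂(volume.restrict {x : EuclideanSpace ℝ (Fin 3) | ∀ i : Fin 3, |x i| < 1}), Ut x = U x) ∧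
        (∀ᵐ x ∂(volume.restrict {x : EuclideanSpace ℝ (Fin 3) | ∀ i : Fin 3, |x i| < 1}), G x = fderiv ℝ Ut x)) :
    ∀ (Λ ε : ℝ), 0 < Λ → Λ ≤ 21 → 0 < ε → ∃ r₁ : ℝ, 0 < r₁ ∧ r₁ ≤ 1 / 8 ∧
      ∀ (hQ : IsOpen {x : EuclideanSpace ℝ (Fin 3) | ∀ i : Fin 3, |x i| < 1}) (U : EuclideanSpace ℝ (Fin 3) → EuclideanSpace ℝ (Fin 4)) (G : EuclideanSpace ℝ (Fin 3) → (EuclideanSpace ℝ (Fin 3) →L[ℝ] EuclideanSpace ℝ (Fin 4))),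
      Literature.Analysis.FunctionSpaces.HasWeakFDerivOn ⟨{x : EuclideanSpace ℝ (Fin 3) | ∀ i : Fin 3, |x i| < 1}, hQ⟩ volume U G →
      (∀ x : EuclideanSpace ℝ (Fin 3), (∀ i : Fin 3, |x i| < 1) → ‖U x‖ = 1) →
      MeasureTheory.IntegrableOn (fun x => ∑ i : Fin 3, ‖G x (EuclideanSpace.single i (1:ℝ))‖ ^ 2)
        {x : EuclideanSpace ℝ (Fin 3) | ∀ i : Fin 3, |x i| < 1} →
      (∀ (V : EuclideanSpace ℝ (Fin 3) → EuclideanSpace ℝ (Fin 4)) (GV : EuclideanSpace ℝ (Fin 3) → (EuclideanSpace ℝ (Fin 3) →L[ℝ] EuclideanSpace ℝ (Fin 4))) (s : ℝ), s < 1 →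
        Literature.Analysis.FunctionSpaces.HasWeakFDerivOn ⟨{x : EuclideanSpace ℝ (Fin 3) | ∀ i : Fin 3, |x i| < 1}, hQ⟩ volume V GV →
        (∀ x : EuclideanSpace ℝ (Fin 3), (∀ i : Fin 3, |x i| < 1) → ‖V x‖ = 1) →
        MeasureTheory.IntegrableOn (fun x => ∑ i : Fin 3, ‖GV x (EuclideanSpace.single i (1:ℝ))‖ ^ 2)
        {x : EuclideanSpace ℝ (Fin 3) | ∀ i : Fin 3, |x i| < 1} →
        (∀ x : EuclideanSpace ℝ (Fin 3), (∃ i : Fin 3, s ≤ |x i|) → V x = U x) →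
        ∫ x in {x : EuclideanSpace ℝ (Fin 3) | ∀ i : Fin 3, |x i| < 1}, ∑ i : Fin 3, ‖G x (EuclideanSpace.single i (1:ℝ))‖ ^ 2 ≤
          ∫ x in {x : EuclideanSpace ℝ (Fin 3) | ∀ i : Fin 3, |x i| < 1}, ∑ i : Fin 3, ‖GV x (EuclideanSpace.single i (1:ℝ))‖ ^ 2) →
      ∫ x in {x : EuclideanSpace ℝ (Fin 3) | ∀ i : Fin 3, |x i| < 1}, ∑ i : Fin 3, ‖G x (EuclideanSpace.single i (1:ℝ))‖ ^ 2 ≤ Λ →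
      ∀ r : ℝ, 0 < r → r ≤ r₁ →
        ∫ x in {x : EuclideanSpace ℝ (Fin 3) | ∀ i : Fin 3, |x i| < r}, ∑ i : Fin 3, ‖G x (EuclideanSpace.single i (1:ℝ))‖ ^ 2 ≤ ε * r :=
  fun Λ ε hΛ _ hε => uniformSmallScaleEnergy_of_rows hMono hCpt hReg Λ ε hΛ hε

end Summit.QuantumFields.YangMills.Theorems.PoincareLipschitzUniformSmallScaleEnergyOfRows

end
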